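import Summits.QuantumFields.YangMills.Theses.BalabanLadder
import Summits.QuantumFields.YangMills.Theorems.BalabanLadderIRColdPressurePincer
import Summits.QuantumFields.YangMills.Theorems.IR.VolumeMonotoneRungStrongCoupling
import Summits.QuantumFields.YangMills.Theorems.IR.TensionRatioDefs
import HarnessLib

/-!
# Line `volume-monotone-gap` for crux `IR` (stmt-QuantumFields-19354) — ideator ym-ir-idea-7 g0 (skeleton v5.4: v5 of g3 re-based by pooled prover ym-ir-line-pool-p3 g5)
# (technique lens: large-N ∕ reduced models as CALIBRATION only)


**v5.4 (2026-08-28, pooled prover ym-ir-line-pool-p3 g5).**  The rung MONO-sc AS TYPED is a THEOREM: `stub_rung_monoStrongCoupling :=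
volumeMonotoneStrongCoupling_holds` (`Theorems/IR/VolumeMonotoneRungStrongCoupling.lean`: ONE `θ = min(1/D,1/4)/8`, `K = max 1 C_st`, `S₀` for all
`β ∈ (0, β_D]`; the v5 «RUNG CORRECTION» inputs are both tree theorems now — (a) `coldPressureBound_strongCoupling_log` (p600923), (b) the β-explicit
ceiling `traceExcess_floor_strongCoupling_uniform` with a β-FREE volume floor, obtained by bounding the two thermal corrections with (a) instead of the
rate-`1/8` bound).  Sorries: 3 line stubs (FV, MONO, R_NSC) + the input T-GAP-FINITE-sc AS TYPED (full window; its engine-window form is proved and is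
all that was ever consumed) = 4.  Registry NOT re-run (LEAD's call).

**v5.3 (2026-08-28, pooled prover ym-ir-line-pool-p3 g5).**  The line's vocabulary (§0: `FiniteVolumeGapSC`, `VolumeMonotoneSC`,
`VolumeMonotoneStrongCoupling`, `VolumeMonotoneStrongCouplingWindow`, `TraceExcessFloorSC`) and the seams of §2 are TREE CONSTANTS
(`Theorems/IR/VolumeMonotoneDefs.lean`, VERBATIM; `coldPressureBound_mono_rate` is `TensionRatio.coldPressureBound_mono_rate`), and the
rung MONO-sc-window is a THEOREM with no open input: `rung_monoStrongCouplingWindow := volumeMonotoneStrongCouplingWindow_holds`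
(`Theorems/IR/VolumeMonotoneWindowRung.lean`), through the input T-GAP-FINITE-sc PROVED ON THE ENGINE WINDOW
(`traceExcessFloorSCWindow_holds : TraceExcessFloorSCWindow`, from `traceExcess_floor_strongCoupling`, `Theorems/IR/VolumeMonotoneTraceExcessFloor.lean`
p624806: `(c₁β⁴)^{m+2} ≤ traceExcess r.ρ β (2S+1) (m+2)` for `β ∈ [β₁, βF]`, `S ≥ S₀(β₁)` — `λ₁/λ₀ ≥ c₁β⁴` volume-uniformly, i.e. the
β-explicit ceiling «input (b)» `m(β,S) ≤ 4 log(1/β) + O(1)`; ingredients: the abstract floor `VolumeMonotoneSpectralFloor{Seq,}` (vacuum lag-one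
covariance floor ⇒ geometric floor on every trace excess; torus covariance ⇒ vacuum covariance up to two trace excesses), the slicing bridge
`VolumeMonotoneSliceBridge`, bsf-p1's β⁴ law `SCFloor.facingPlaquetteCorr_floor_latticeRep`, the rate-`1/8` cold trace bound).  The input AS
TYPED (`stub_input_traceExcessFloor : TraceExcessFloorSC`, window up to `strongCouplingRadius r.ρ` for EVERY `β₁`) stays OPEN: the floor
engine's cap `β₀` may be smaller than `r_ρ` and no tool gives volume-uniform positivity of the facing-plaquette covariance on `(β₀, r_ρ]`
(reflection positivity gives only `≥ 0`) — `traceExcessFloorSC_imp_window` records that the window form is a weakening.  The `(0, β_D]`-uniform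
rung `stub_rung_monoStrongCoupling` stays OPEN: both inputs (a) `coldPressureBound_strongCoupling_log` (p600923) and (b) p624806 are in the tree,
but (b)'s volume floor `S₀(β₁) ≍ 16 log(1/β₁)` is not β-uniform (the β⁴ law is typed on symmetric tori only).  Sorries: 3 line stubs (FV, MONO,
R_NSC) + 2 (MONO-sc as typed, T-GAP-FINITE-sc as typed) — unchanged count, registry NOT re-run (LEAD's call).

LEVER (new on this crux): **spatial-volume monotonicity of the periodic transfer gap beyond ONE calibrated physical
size `ℓ⋆`** («enlarging the spatial torus past `ℓ⋆ ∕ a(β)` sites never halves the transfer gap», stub `VolumeMonotoneSC`),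
composed with **the finite-physical-volume gap** («at every fixed physical size `ℓ ≥ ℓ₀` the periodic transfer gap is
`≥ c(ℓ)·a(β)` for all large `β`», stub `FiniteVolumeGapSC`).  Both are typed in the tree's periodic free-energy currency
`Balaban1983to89.Sufficient.ColdPressureBound ρ β S g C₀` (trace excess of Lüscher's transfer matrix on the spatial torus
`(2S+1)³` in the cold range), so the landed rate seam `ColdPressurePincer.gapInUnits_of_coldPressure_pinned`
(p-lineage of `abs_latticeConnectedCorr_le_of_coldPressure`) is the engine, and the flux-sector half `IRnsc` is carried as
the residual exactly as in the cold-pressure pincer (`IR_of_cases`; its asset is the light-code currency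
`FluxCodeBlindness.IR_of_lightCodePincer`).

CUT (how it differs from the registered lines and the cold-pressure pincer): af-pincer ∕ birth v10 cut `IR` into a per-β
MIXING ONSET (TV∕DLR currency, boundary data) + asymptotic freedom below the onset; the cold-pressure pincer cuts it into a
per-β INFINITE-VOLUME cold-pressure onset `I_cp` (uniform in all large tori at once) + `X_cp`.  Here the infinite-volume
content is isolated in a TWO-VOLUME COMPARISON at fixed `β` (`VolumeMonotoneSC`: size `S` versus size `S' ≥ S`, both finite),
and everything else is a ONE-VOLUME statement at fixed physical size (`FiniteVolumeGapSC`: a UV ∕ finite-volume spectral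
problem — continuum limit of the transfer gap in a box of fixed physical size — not confinement-scale thermodynamics).

CALIBRATION (why the two stubs are believed, and where `ℓ⋆` sits — the lens): (1) large-`N` volume independence
(Eguchi–Kawai; Narayanan–Neuberger ∕ Kiskis–Narayanan–Neuberger 2003: at `N = ∞` torus physics is EXACTLY size-independent
beyond `ℓ_c = 1∕T_c`, so `VolumeMonotoneSC` holds with `K = 1` and no rate loss beyond `ℓ⋆ = ℓ_c`); (2) Lüscher's finite-size
mass shift (Commun. Math. Phys. 104 (1986) 177: the leading correction to the lightest mass is NEGATIVE, `m(ℓ) ↑ m(∞)`);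
(3) lattice spectra (SU(2)∕SU(3): the `A₁⁺` mass dips in intermediate volumes `z = mℓ ≈ 1–5` and rises monotonically
after; torelon levels `≈ σℓ` rise); (4) van Baal–Koller's zero-mode effective Hamiltonian reproduces the finite-volume
spectrum up to `z ≈ 5`, i.e. up to `ℓ⋆` — the documented supplier route for `FiniteVolumeGapSC` is the femto engine of
route `LuscherReduction` (R2b′) pushed to `z ≈ 5`, NOT a weak-coupling cluster expansion.  Calibration is NOT proof:
`VolumeMonotoneSC` is a typed conjectural obligation (false below `ℓ⋆`: at criticality `m(S') = m(S)·S∕S'`).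

RUNG CORRECTION (v5, g3 — honest re-pricing of the strong-coupling rung).  The rung `VolumeMonotoneStrongCoupling` (MONO-sc,
ALL `β ∈ (0, β_D]`, ONE `θ`) is NOT landable from the tree's strong-coupling theorems and is not «size L»: the floor `1 ≤ C₀`
lets the hypothesis carry ANY rate `g ≤ m(β, S)` (the torus transfer gap, `≈ −4 ln u(β) → ∞` as `β → 0⁺`), so the conclusion
must be certified at rate `θ·m(β, S)` UNIFORMLY down to `β → 0⁺`, while the tree certifies the volume-uniform rate `1∕8`
(`ColdPressurePincer.coldPressureAt_strongCoupling`, constant universal).  On ALL of `(0, β_D]` this needs TWO inputs absent from the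
tree: (a) a RATE-TRACKING strong-coupling cold-pressure bound (a time-wrapping cluster of the tree's plaquette-polymer gas on the
`(m+2) × (2S'+1)³` torus has `≥ m+2` plaquettes, each carrying activity `≲ C′β` instead of the Kotecký–Preiss slack `1∕2`, so the SAME
expansion as `Missing.coldFreeEnergyBound_of_strongCoupling` — which books the β-independent rate `1∕4` — gives rate `κ ln(1∕(C′β)) → ∞`,
`κ = 1` for plaquette polymers (`κ = 4` for a closed-surface ∕ character expansion); an M–L refactor, upper bounds only) and (b) the
β-explicit transfer-gap CEILING `m(β, S) ≤ 4 ln(1∕β) + c′` uniformly in `S` (variational principle + the floor `Cov_vac(P₀, P₁) ≥ c β⁴`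
on ONE connected plaquette correlator at time distance 1; L) — then MONO-sc holds with `θ = κ∕5` on `(0, β⋆]` (its `∃ θ` form asks no
more); NO Schor-type spectral theory is needed (the earlier docstring's «OS78 ∕ Münster, size L» named neither input).  The
cheaply landable shape is the WINDOW rung `VolumeMonotoneStrongCouplingWindow` (`β ∈ [β₁, β_D]`, `θ = θ(β₁)`), and v5 PROVES it from ONE
named strong-coupling input `TraceExcessFloorSC` («the torus transfer gap is FINITE uniformly in the volume on `[β₁, r_ρ]`»:
`e^{−M(m+2)} ≤ traceExcess`, i.e. `λ₁∕λ₀ ≥ e^{−M}`; Montvay–Münster glueball mass `m = −4 ln u + …`; provable by the variational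
principle from a volume-uniform floor on ONE connected plaquette correlator at time distance 1 — a fixed-order cluster-expansion
statement, size L; the tree's DLR total-covariance transfer `LatticeGaugeDLRCovarianceSplit.latticeConnectedCorr_ge_of_boxKernel_condCov`
is the box-to-torus tool for such floors): `monoWindow_of_traceExcessFloor` (real proof: the floor forces `g ≤ M`, then
`θ := 1∕(8·max M 1)`, `K := max 1 A_sc` and the tree's rate-`1∕8` bound; the ceiling step is the reusable seam `rate_le_of_traceExcessFloor`).  `monoWindow_of_mono` records that the window rung is
weaker than MONO-sc.  Sorries ONLY inside `stub_*` (3 line stubs + 2 rung∕input stubs not consumed by `IR_of`).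

HONEST FRAMING: a kernel-checked CONDITIONAL reduction of ONE binder (`IR`, rung R2c) of a CONDITIONAL chain; both new stubs
are OPEN; the YM mass gap (Clay) is NOT proved by any of this; R4 closes only the conditional finite-𝕋⁴ rung
`BalabanLadder.UV`.
-/

set_option autoImplicit false

noncomputable section

open Filter Topology MeasureTheory
open Literature.MathematicalPhysics.QuantumFieldTheory Literature.MathematicalPhysics.QuantumLattice
open Summit.QuantumFields.YangMills.Cruxes.OSLegsFromFemtoAndGap.DlrCollarTransfer (GapInUnits LowerBounds)
open Literature.MathematicalPhysics.QuantumFieldTheory.Balaban1983to89.Sufficient (ColdPressureBound)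
open Literature.MathematicalPhysics.QuantumFieldTheory.Balaban1983to89.Sufficient (ColdTraceBound
  coldPressureBound_of_coldTraceBound)
open Literature.MathematicalPhysics.QuantumFieldTheory.Balaban1983to89.Missing (ColdFreeEnergyBound
  strongCouplingRadius strongCouplingRadius_pos coldFreeEnergyBound_of_strongCoupling coldTraceBound_of_coldFreeEnergyBound)
open Summit.QuantumFields.YangMills.Cruxes.IR.ColdPressurePincer
  (ColdPressureAt cpLength cpLength_le IRsc IRnsc IR_of_cases gapInUnits_of_coldPressure_pinned)

open Summit.QuantumFields.YangMills.Cruxes.IR.TensionRatio (coldPressureBound_mono_rate)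

namespace Summit.QuantumFields.YangMills.Cruxes.IR.VolumeMonotone

/-! ## §0 The stub STATEMENTS — TREE CONSTANTS (imported VERBATIM from `Theorems/IR/VolumeMonotoneDefs.lean`, not restated):
`FiniteVolumeGapSC`, `VolumeMonotoneSC`, `VolumeMonotoneStrongCoupling`, `VolumeMonotoneStrongCouplingWindow`, `TraceExcessFloorSC`, `TraceExcessFloorSCWindow`. -/

/-! ## §1 Registered stubs -/

/-- stub **FV** (finite-physical-volume transfer gap in units; documented supplier: femto engine of `LuscherReduction`
pushed to `z ≈ 5`).  Why it might fail: spectral (norm-resolvent-type) convergence of transfer matrices in the continuum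
limit is more than R4's convergence of expectations; at `ℓ ≈ ℓ⋆` the zero-mode Hamiltonian is beyond the sphaleron. -/
theorem stub_finiteVolumeGap : FiniteVolumeGapSC := by
  sorry

/-- stub **MONO** (volume monotonicity beyond `ℓ⋆`, `∃ θ` form).  Why it might fail: a level that DEcreases with the
volume in the neutral sector past `ℓ⋆` (none known: glueball-at-rest rises by Lüscher's sign, two-torelon states rise like
`2σℓ`; moving glueballs are not the minimum), or amplitude irregularity making `K` volume-dependent. -/
theorem stub_volumeMonotone : VolumeMonotoneSC := by
  sorry

/-- stub **R_NSC** (RESIDUAL, the flux-sector half — the crux restricted to `π₁(G) ≠ 1`, tree constant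
`ColdPressurePincer.IRnsc`; the periodic free-energy currency counts the `|π₁(G)|³` light magnetic-flux vacua
(`IR/Negative/ColdPressureOnsetFalseOfLightFlux`), so this half is NOT attacked here; asset: `FluxCodeBlindness`). -/
theorem stub_irNSC : IRnsc := by
  sorry

/-- **rung MONO-sc — PROVED** (tree `volumeMonotoneStrongCoupling_holds`, `Theorems/IR/VolumeMonotoneRungStrongCoupling.lean`, pool-p3 g5; v5–v5.3
listed it as two inputs short).  Kept under the registered stub name; no `sorry`. -/
theorem stub_rung_monoStrongCoupling : VolumeMonotoneStrongCoupling :=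
  volumeMonotoneStrongCoupling_holds

/-- input stub **T-GAP-FINITE-sc AS TYPED** (`TraceExcessFloorSC`: window up to `strongCouplingRadius r.ρ` for EVERY `β₁`; not consumed by `IR_of`).
v5.3: PROVED on the engine window (`input_traceExcessFloorWindow : TraceExcessFloorSCWindow` below, tree `traceExcessFloorSCWindow_holds`), which is
all the window rung needs; as typed it stays open only on `(β₀, r_ρ]` (no volume-uniform positivity tool for the facing-plaquette covariance beyond the
β⁴-law cap `β₀`). -/
theorem stub_input_traceExcessFloor : TraceExcessFloorSC := by
  sorry

/-! ## §2 Seams — TREE CONSTANTS (`coldPressureBound_mono_const`, `rate_le_of_traceExcessFloor` in `VolumeMonotoneDefs`;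
`TensionRatio.coldPressureBound_mono_rate` in `TensionRatioDefs`). -/

/-! ### §2b The window rung, PROVED from the named input (v5) -/

/-- The window rung is weaker than MONO-sc (uniform constants serve every window). -/
theorem monoWindow_of_mono (h : VolumeMonotoneStrongCoupling) : VolumeMonotoneStrongCouplingWindow := by
  intro G _ _ _ _ hG hsc
  letI : MeasurableSpace G := borel G
  haveI : BorelSpace G := ⟨rfl⟩
  intro r
  obtain ⟨βD, hβD, θ, hθ, hθ1, K, hK, S₀, h⟩ := h G hG hsc r
  exact ⟨βD, hβD, fun β₁ hβ₁ _ => ⟨θ, hθ, hθ1, K, hK, S₀, fun β hβ hβ' S S' hS hSS' g C₀ hg hC₀ hcp =>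
    h β (lt_of_lt_of_le hβ₁ hβ) hβ' S S' hS hSS' g C₀ hg hC₀ hcp⟩⟩

/-- **`TraceExcessFloorSC ⇒ VolumeMonotoneStrongCouplingWindow` (real proof; v5.3: through the window form).** -/
theorem monoWindow_of_traceExcessFloor (hF : TraceExcessFloorSC) : VolumeMonotoneStrongCouplingWindow :=
  monoWindow_of_traceExcessFloorWindow (traceExcessFloorSC_imp_window hF)

/-- **input T-GAP-FINITE-sc on the ENGINE window — PROVED** (tree `traceExcessFloorSCWindow_holds`, pool-p3 g5). -/
theorem input_traceExcessFloorWindow : TraceExcessFloorSCWindow :=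
  traceExcessFloorSCWindow_holds

/-- **The window rung — PROVED, no open input** (tree `volumeMonotoneStrongCouplingWindow_holds`, `Theorems/IR/VolumeMonotoneWindowRung.lean`,
pool-p3 g5; v5–v5.2 derived it from the sorried `stub_input_traceExcessFloor`). -/
theorem rung_monoStrongCouplingWindow : VolumeMonotoneStrongCouplingWindow :=
  volumeMonotoneStrongCouplingWindow_holds

/-- **FV ∧ MONO ⇒ `IRsc` (real proof).**  At `ℓ := max ℓ₀ ℓ⋆`, FV gives the cold trace bound at size `⌈ℓ ∕ a β⌉₊` with rate
`c·a β` (constant bumped to `max C₀ 1`); MONO transports it to every larger size with rate `θ·c·a β` and constant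
`K·max C₀ 1`; this is per-β cold pressure at the length `ξ(β) = ⌈1 ∕ (θ c·a β)⌉₊`, pinned by
`a β · ξ(β) ≤ 1∕(θc) + a β < 1∕(θc) + 2`; the landed rate seam `gapInUnits_of_coldPressure_pinned` concludes. -/
theorem irsc_of_fv_mono (hFV : FiniteVolumeGapSC) (hM : VolumeMonotoneSC) : IRsc := by
  intro G _ _ _ _ hG hsc
  letI : MeasurableSpace G := borel G
  haveI : BorelSpace G := ⟨rfl⟩
  intro r a ha ha0 hlb
  obtain ⟨ℓ₀, hℓ⟩ := hFV G hG hsc r a ha ha0 hlb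
  obtain ⟨ℓs, hℓs, θ, hθ, hθ1, K, hK, β₃, hmono⟩ := hM G hG hsc r a ha ha0 hlb
  obtain ⟨c, hc, C₀, hC₀, β₂, hfv⟩ := hℓ (max ℓ₀ ℓs) (le_max_left _ _)
  -- eventually `a β ≤ 1`
  obtain ⟨β₇, hβ₇⟩ : ∃ β₇ : ℝ, ∀ β : ℝ, β₇ ≤ β → a β ≤ 1 := by
    have hev : ∀ᶠ β in atTop, a β < 1 := ha0.eventually (gt_mem_nhds one_pos)
    obtain ⟨β₇, h⟩ := Filter.eventually_atTop.1 hev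
    exact ⟨β₇, fun β hβ => (h β hβ).le⟩
  have hC1 : 1 ≤ max C₀ 1 := le_max_right _ _
  have hKC : 0 ≤ K * max C₀ 1 := mul_nonneg (by linarith) (by linarith)
  -- per-β cold pressure on all tori beyond `⌈ℓ ∕ a β⌉₊`, rate `θ c a β`
  have hcp : ∀ β : ℝ, max β₂ β₃ ≤ β → ∀ S' : ℕ, ⌈max ℓ₀ ℓs / a β⌉₊ ≤ S' →
      ColdPressureBound r.ρ β S' (θ * (c * a β)) (K * max C₀ 1) := by
    intro β hβ S' hS'
    have hβ2 : β₂ ≤ β := le_trans (le_max_left _ _) hβ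
    have hβ3 : β₃ ≤ β := le_trans (le_max_right _ _) hβ
    have hapos := ha β
    have hS : ℓs ≤ a β * (⌈max ℓ₀ ℓs / a β⌉₊ : ℕ) := by
      have hce : max ℓ₀ ℓs / a β ≤ ((⌈max ℓ₀ ℓs / a β⌉₊ : ℕ) : ℝ) := Nat.le_ceil _
      calc ℓs ≤ max ℓ₀ ℓs := le_max_right _ _
        _ = a β * (max ℓ₀ ℓs / a β) := by field_simp
        _ ≤ a β * ((⌈max ℓ₀ ℓs / a β⌉₊ : ℕ) : ℝ) := mul_le_mul_of_nonneg_left hce hapos.le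
    exact hmono β hβ3 _ S' hS hS' (c * a β) (max C₀ 1) (by positivity) hC1
      (coldPressureBound_mono_const (hfv β hβ2) (le_max_left _ _))
  -- `1 / ⌈1/(θ c a β)⌉₊ ≤ θ c a β`
  have hrate : ∀ β : ℝ, 1 / ((⌈1 / (θ * (c * a β))⌉₊ : ℕ) : ℝ) ≤ θ * (c * a β) := by
    intro β
    have hapos := ha β
    have hx : 0 < 1 / (θ * (c * a β)) := by positivity
    have hce : 1 / (θ * (c * a β)) ≤ ((⌈1 / (θ * (c * a β))⌉₊ : ℕ) : ℝ) := Nat.le_ceil _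
    calc 1 / ((⌈1 / (θ * (c * a β))⌉₊ : ℕ) : ℝ) ≤ 1 / (1 / (θ * (c * a β))) := one_div_le_one_div_of_le hx hce
      _ = θ * (c * a β) := by field_simp
  have hξ1 : ∀ β : ℝ, 1 ≤ ⌈1 / (θ * (c * a β))⌉₊ := by
    intro β
    have hapos := ha β
    have hx : 0 < 1 / (θ * (c * a β)) := by positivity
    exact Nat.one_le_iff_ne_zero.2 (Nat.pos_iff_ne_zero.1 (Nat.ceil_pos.2 hx))
  -- the per-β admissible length `ξ(β) := ⌈1/(θ c a β)⌉₊`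
  have hat : ∀ β : ℝ, max β₂ β₃ ≤ β → ColdPressureAt r.ρ β ⌈1 / (θ * (c * a β))⌉₊ := fun β hβ =>
    ⟨K * max C₀ 1, ⌈max ℓ₀ ℓs / a β⌉₊, hKC, fun S hS =>
      coldPressureBound_mono_rate (hcp β hβ S hS) hKC (hrate β)⟩
  have hon : ∀ β : ℝ, max β₂ β₃ ≤ β → ∃ ξ : ℕ, 1 ≤ ξ ∧ ColdPressureAt r.ρ β ξ := fun β hβ =>
    ⟨_, hξ1 β, hat β hβ⟩
  -- the pin `a β · ξ⋆(β) < 1/(θ c) + 2`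
  have hpin : ∀ β : ℝ, max (max β₂ β₃) β₇ ≤ β → a β * (cpLength r.ρ β : ℝ) < 1 / (θ * c) + 2 := by
    intro β hβ
    have hβ23 : max β₂ β₃ ≤ β := le_trans (le_max_left _ _) hβ
    have hβ7 : β₇ ≤ β := le_trans (le_max_right _ _) hβ
    have hapos := ha β
    have ha1 := hβ₇ β hβ7
    have hx : 0 < 1 / (θ * (c * a β)) := by positivity
    have hle : cpLength r.ρ β ≤ ⌈1 / (θ * (c * a β))⌉₊ := cpLength_le r.ρ β (hξ1 β) (hat β hβ23)
    have hle' : (cpLength r.ρ β : ℝ) ≤ ((⌈1 / (θ * (c * a β))⌉₊ : ℕ) : ℝ) := by exact_mod_cast hle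
    have hlt : ((⌈1 / (θ * (c * a β))⌉₊ : ℕ) : ℝ) < 1 / (θ * (c * a β)) + 1 := Nat.ceil_lt_add_one hx.le
    have h1 : a β * (cpLength r.ρ β : ℝ) ≤ a β * ((⌈1 / (θ * (c * a β))⌉₊ : ℕ) : ℝ) :=
      mul_le_mul_of_nonneg_left hle' hapos.le
    have h2 : a β * ((⌈1 / (θ * (c * a β))⌉₊ : ℕ) : ℝ) < a β * (1 / (θ * (c * a β)) + 1) :=
      mul_lt_mul_of_pos_left hlt hapos
    have h3 : a β * (1 / (θ * (c * a β)) + 1) = 1 / (θ * c) + a β := by field_simp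
    linarith
  exact gapInUnits_of_coldPressure_pinned r a ha ha0 hon hpin

/-! ## §3 Composition: the crux `IR` BY NAME -/

/-- **Composition (kernel-checked; the only sorries are the three registered stubs it names):**
`stub_finiteVolumeGap ∧ stub_volumeMonotone ∧ stub_irNSC ⇒` crux `IR` BY NAME, via the proved seam `irsc_of_fv_mono` and the landed
case split `ColdPressurePincer.IR_of_cases`. -/
theorem IR_of : Summit.QuantumFields.YangMills.Theses.BalabanLadder.IR :=
  IR_of_cases (irsc_of_fv_mono stub_finiteVolumeGap stub_volumeMonotone) stub_irNSC

end Summit.QuantumFields.YangMills.Cruxes.IR.VolumeMonotone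

end
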